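import Literature.MathematicalPhysics.QuantumFieldTheory.Balaban1983to89.B9GradLetterTransportedInputClassesPI
import Literature.MathematicalPhysics.QuantumFieldTheory.Balaban1983to89.B9Thm312WholeDir
import Literature.MathematicalPhysics.QuantumFieldTheory.Balaban1983to89.B9BackgroundsKLevelV1R
import Literature.MathematicalPhysics.QuantumFieldTheory.Balaban1983to89.B9CoReadingCoordsH
import Literature.MathematicalPhysics.QuantumFieldTheory.Balaban1983to89.B9RWSums347DefiniteFaces

/-!
# BalabanUVNodes ∕ N06 ([B9], `Dag.B9_main`) — THE SMOOTH-SOURCE LETTERS `hdgDvd13` (∇_{U,ν}G₀D_U) AND `hpdgDvd13` (Φ^X_β∇_{U,ν}G₀D_U) AT THE TRANSPORTED W-SECTOR CLASS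
# `bHXT x U = bHZPIfam (taxiS U)`, MEMBER-UNIFORMLY, FROM A G₀ LAYER AT THE TRANSPORTED BOND CLASS `bHXTA x U = bHZKPIfam (taxiB U)` — the LEG of the no-K1-change road of
# `LOCATED22-ADOPTION-MEMO-g21.md` §3 (dag-n06-c g21; road confirmed by dag-n06-l g32: the face's W slot `bHW13` is free and U-dependent)

Track A of `YM-PLAN.md` (cell `pub-ymgap`, HUMAN RULING D-0062), node **N06** = [Balaban1985BackgroundPropagators] Thms 3.1–3.15; rows 20–21; seat `pub-ymgap-dag-n06-c` (g21).
A HELPER for dag-n06-d's certificate editions after ED.101 «VB»: there `hdgDvd13 ∕ hpdgDvd13` are displayed at the FLAT site class `bHX` because the certificate instantiates the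
face's W-sector slot `(bHW13 := fun x _ => bHX x)`; the slot is free (face `t312_t313_of_pins_stateSUC(L)` and leaf `…CompletePairMBCZcUSXC(L)`: κ-bound, ℓ¹-domination, the U8
W-member, and these letters only), so `bHW13 := bHXT` (the transported site input class, displayed since ED.95 with `hopI`) is admissible, and THIS FILE supplies the two letters
there: ★★★ `dgDvd_pdgDvd_of_pinsT` — from a G₀ layer `hG0CT : Thm33G0Dir (𝔬12 x) (𝔭A x) (Dd x) (Dds x) 1 (H x) (bHXTA x U) …` at the transported BOND class (dag-n06-d's second
`g0_layer_of_thm310_coreDir₃US…` instance fed by `hopIA`), the pins `hDvco12` (D_U = def-Y's `DvcoKH`), `hDds` (the certificate's `h𝔡As`), `hbHXT ∕ hbHXTA`, `hβ1`, the class axiom in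
print's form (`hP : Reg335 → (bg9KP …).Reg335 c10`, `c10 ≤ 10`, the certificate's `hRP1 … .2.1`, `c35Y_le_ten`), ∃ `MD ≥ MT` and ε-profiles `BdT, Bd2T ≥ 0` such that above `MD`,
in the layer's regime: `∀ ν ε, 0<ε≤1 → HasMaj (bHXT x U ε) (ofBlocks (𝔬12 x).blk) (Dd x U ν ∘ₗ ((𝔬12 x).G0 U ∘ₗ (𝔬12 x).Dv U)) (BdT ε·e^{−δ12₃d})` and
`∀ ν ε β, … → HasMaj (bHXT x U (β+ε)) (ofBlocks (𝔭A x).blkPX) (((𝔭A x).ΦX U β ∘ₗ Dd x U ν) ∘ₗ ((𝔬12 x).G0 U ∘ₗ (𝔬12 x).Dv U)) (Bd2T ε β·len^{−β}·e^{−δ12₃d})` — verbatim the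
displayed shapes with `bHX ↦ bHXT x U`.  Inside: `B9GradLetterTransportedInputClassesPI.hasMaj_dgDv_of_h44m ∕ hasMaj_pdgDv_of_h45m` (the letter `J_μ` between the transported
classes `B9GradLetterTransportedInputClasses` + D1a's ladder under (3.35) + n06-l's `DvFromDds` algebra norm-generic), the transfer threshold `log L∕(2L²−1)` ([4] (2.60) at rate 1),
`rowSum261_geo9Y` at margin 1, and `Θ(α₀) = (d+1)K_pl(10L·Mα₀)L⁶ ≤ Θ(aT)` on the regime `Mα₀ ≤ aT`.
HONEST FRAMING.  By-name composition of kernel-checked helper files; the G₀ layer at the transported class is a HYPOTHESIS (derived by the certificate); COUNT-NEUTRAL;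
nothing of [B9]'s propagator estimates asserted; N06 NOT discharged; K1 NOT closed; one finite 𝕋⁴ programme at fixed `ε` — NOT continuum, NOT OS, NOT the mass gap ∕ Clay.
0 `def`, 0 `sorry`.
-/

noncomputable section

namespace Summit.QuantumFields.YangMills.BalabanUVNodes.N06DgDvdLegAtPinsT

open Literature.MathematicalPhysics.QuantumFieldTheory.Balaban1983to89
open Literature.MathematicalPhysics.QuantumFieldTheory.Balaban1983to89.Node00
open Literature.MathematicalPhysics.QuantumFieldTheory.Balaban1983to89.Node00.OpsYSectDCoords (DvcoKH)
open Literature.MathematicalPhysics.QuantumFieldTheory.Balaban1983to89.Node00.OpsYNablaBridge (chartY)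
open Literature.MathematicalPhysics.QuantumFieldTheory.Balaban1983to89.B9Thm34Ext (toB6)
open Literature.MathematicalPhysics.QuantumFieldTheory.Balaban1983to89.B11SectG (BlockNorm HasMaj RowSum)
open Literature.MathematicalPhysics.QuantumFieldTheory.Balaban1983to89.B9Thm312Whole (GeoOK)
open Literature.MathematicalPhysics.QuantumFieldTheory.Balaban1983to89.B9Thm312WholeDir (Thm33G0Dir)
open Literature.MathematicalPhysics.QuantumFieldTheory.Balaban1983to89.B9RWSums343Holder (HolderProbes)
open Literature.MathematicalPhysics.QuantumFieldTheory.Balaban1983to89.B9PinMembersKLevelV1 (MemberY geo9Y)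
open Literature.MathematicalPhysics.QuantumFieldTheory.Balaban1983to89.B9BackgroundsKLevelV1R (RegFamY bg9YR)
open Literature.MathematicalPhysics.QuantumFieldTheory.Balaban1983to89.B9BackgroundsKLevelV1P (bg9KP mem_of_reg335P)
open Literature.MathematicalPhysics.QuantumFieldTheory.Balaban1983to89.B9GeoLemma21KLevelV1 (geo9Y_len_pos geo9Y_dist_triangle geo9Y_dist_comm rowSum261_geo9Y)
open Literature.MathematicalPhysics.QuantumFieldTheory.Balaban1983to89.B9GeoNormsKLevelV1 (geo9K geo9K_dist_nonneg)
open Literature.MathematicalPhysics.QuantumFieldTheory.Balaban1983to89.B7Prop2SpecialUnitary (specialUnitaryUnits specialUnitaryUnits_le_U1)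
open Literature.MathematicalPhysics.QuantumFieldTheory.Balaban1983to89.B9CoReadingCoords (XBK coordOpK cdsBₗ)
open Literature.MathematicalPhysics.QuantumFieldTheory.Balaban1983to89.B9CoReadingCoordsS (XSK)
open Literature.MathematicalPhysics.QuantumFieldTheory.Balaban1983to89.B9CoReadingCoordsTranspose (TrIdx trBasis)
open Literature.MathematicalPhysics.QuantumFieldTheory.Balaban1983to89.B9Thm39ReadingCoords (coordBound39 basisBound39)
open Literature.MathematicalPhysics.QuantumFieldTheory.Balaban1983to89.B9MultiscaleSmoothPartitionYLip (CLip CLip_nonneg)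
open Literature.MathematicalPhysics.QuantumFieldTheory.Balaban1983to89.B9MultiscaleSmoothPartitionYNear (rNear)
open Literature.MathematicalPhysics.QuantumFieldTheory.Balaban1983to89.B9SmoothHolderClassPI (bHZPIfam bHZKPIfam transfer_threshold_geo9K)
open Literature.MathematicalPhysics.QuantumFieldTheory.Balaban1983to89.B9SmoothHolderClassTClosure (abs_cf_eq_nKT)
open Literature.MathematicalPhysics.QuantumFieldTheory.Balaban1983to89.B9SectBGpLettersY (norm_le_one_and_inv_of_mem)
open Literature.MathematicalPhysics.QuantumFieldTheory.Balaban1983to89.B9GradViaDivLettersTransported (taxiS taxiB)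
open Literature.MathematicalPhysics.QuantumFieldTheory.Balaban1983to89.B9GradLetterTransportedInputClassesPI (jLadder_hyp_of_reg335P hasMaj_dgDv_of_h44m hasMaj_pdgDv_of_h45m)
open Literature.MathematicalPhysics.QuantumFieldTheory.Balaban1983to89.B6GlobalChartV1 (blkV1)
open Literature.MathematicalPhysics.QuantumFieldTheory.Balaban1983to89.B6Ineq2142KLevelV1 (β)
open Literature.MathematicalPhysics.QuantumFieldTheory.Balaban1983to89.B6Geom246MultiLevelTorus (geomT)
open Literature.MathematicalPhysics.QuantumFieldTheory.Balaban1983to89.B6KLevelCensusIndexV1 (kGeo Adm)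
open T4RelativeLadder (UnitaryLike)
open scoped Matrix.Norms.L2Operator

variable {N : ℕ} [NeZero N]
variable {d ℓ : ℕ} {hd : 1 ≤ d + 1} {hL : Odd (ℓ + 1) ∧ 1 < ℓ + 1} {b₀ b₁ : ℝ} {Mstar : ℕ}
variable [∀ x : MemberY d ℓ hd hL b₀ b₁ Mstar, Fintype (geo9Y x).Site]

set_option maxHeartbeats 1600000 in -- the member-level instantiation of the norm-generic core unfolds `bg9YR … x` ∕ `geo9Y x` at every pin
/-- ★★★ **`hdgDvd13 ∕ hpdgDvd13` AT THE TRANSPORTED W-SECTOR CLASS, MEMBER-UNIFORMLY** (module docstring): from the G₀ layer at the transported bond input class (`hG0CT`), the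
pins `hDvco12 hDds hbHXT hbHXTA hβ1`, print's class (`hP`, `c10 ≤ 10` — SU(N)-membership of the links comes from `hP`, no `hGR` needed) and `0 ≤ δ12₃ ≤ δ12₀`: ∃ `MD ≥ MT`, `BdT ≥ 0`, `Bd2T ≥ 0` (ε-profiles) such that above `MD` and in the layer's regime
the two letters hold at `(BdT ε, δ12₃)` ∕ `(Bd2T ε β, δ12₃)` with source class `bHXT x U`.
[cite: Balaban1985BackgroundPropagators, Thm 3.3 (3.45) p.398 + (3.3) p.391 + (3.40) p.397 + (3.35) p.396 + (3.133) p.422; Balaban1984PropagatorsII, (2.51)–(2.56) pp.232–233, Lemma 2.1 (2.60)–(2.61) p.234, (2.137) p.247] -/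
theorem dgDvd_pdgDvd_of_pinsT {R₁ R₂ : RegFamY d ℓ hd hL b₀ b₁ Mstar (Matrix (Fin N) (Fin N) ℂ)} (H : MemberY d ℓ hd hL b₀ b₁ Mstar → Prop)
    (bI : ∀ x : MemberY d ℓ hd hL b₀ b₁ Mstar, FBondY x.toKIdx → IBondY x.toKIdx)
    (hβ1 : ∀ (x : MemberY d ℓ hd hL b₀ b₁ Mstar) (f : FBondY x.toKIdx),
      (geomT x.toKIdx.D).dist (β x.toKIdx.hN x.toKIdx.D x.toKIdx.hk (bI x f)) (blkV1 x.toKIdx.hN x.toKIdx.D f) ≤ 1)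
    {Z12 : MemberY d ℓ hd hL b₀ b₁ Mstar → Type} [∀ x, Fintype (Z12 x)] {PXA PYA : MemberY d ℓ hd hL b₀ b₁ Mstar → Type} [∀ x, Fintype (PXA x)] [∀ x, Fintype (PYA x)]
    (𝔬12 : ∀ x : MemberY d ℓ hd hL b₀ b₁ Mstar, B9Thm312Whole.Ops (geo9Y x) (bg9YR (Matrix (Fin N) (Fin N) ℂ) (specialUnitaryUnits (Fin N)) R₁ R₂ x)
      (XBK (TrIdx N) x.toKIdx) (XBK (TrIdx N) x.toKIdx) (Z12 x) (XSK (TrIdx N) x.toKIdx))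
    (𝔭A : ∀ x : MemberY d ℓ hd hL b₀ b₁ Mstar, HolderProbes (geo9Y x) (bg9YR (Matrix (Fin N) (Fin N) ℂ) (specialUnitaryUnits (Fin N)) R₁ R₂ x)
      (XBK (TrIdx N) x.toKIdx) (XBK (TrIdx N) x.toKIdx) (PXA x) (PYA x))
    (Dd Dds : ∀ x : MemberY d ℓ hd hL b₀ b₁ Mstar, (bg9YR (Matrix (Fin N) (Fin N) ℂ) (specialUnitaryUnits (Fin N)) R₁ R₂ x).Cfg → Fin (d + 1) →
      Module.End ℝ (XBK (TrIdx N) x.toKIdx → ℝ))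
    (hDds : ∀ (x : MemberY d ℓ hd hL b₀ b₁ Mstar) (U : (bg9YR (Matrix (Fin N) (Fin N) ℂ) (specialUnitaryUnits (Fin N)) R₁ R₂ x).Cfg),
      Dds x U = fun μ => coordOpK (trBasis N) (fun _ : Fin (d + 1) => cdsBₗ x.toKIdx U μ))
    (hDvco12 : ∀ (x : MemberY d ℓ hd hL b₀ b₁ Mstar) (U : (bg9YR (Matrix (Fin N) (Fin N) ℂ) (specialUnitaryUnits (Fin N)) R₁ R₂ x).Cfg),
      (𝔬12 x).Dv U = DvcoKH x.toKIdx (trBasis N) (bg9YR (Matrix (Fin N) (Fin N) ℂ) (specialUnitaryUnits (Fin N)) R₁ R₂ x) (fun U => U) U)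
    -- the transported input classes of record (ED.95's `hbHXT ∕ hbHXTA`)
    (bHXT : ∀ x : MemberY d ℓ hd hL b₀ b₁ Mstar, (bg9YR (Matrix (Fin N) (Fin N) ℂ) (specialUnitaryUnits (Fin N)) R₁ R₂ x).Cfg → ℝ →
      BlockNorm (toB6 (geo9Y x) 1 (H x)) (XSK (TrIdx N) x.toKIdx → ℝ))
    (hbHXT : ∀ (x : MemberY d ℓ hd hL b₀ b₁ Mstar) (U : (bg9YR (Matrix (Fin N) (Fin N) ℂ) (specialUnitaryUnits (Fin N)) R₁ R₂ x).Cfg), bHXT x U = fun ε =>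
      letI : Fintype (geo9K x.toKIdx).Site := (inferInstance : Fintype (geo9Y x).Site)
      bHZPIfam (κ := TrIdx N) x.toKIdx (trBasis N) (taxiS x.toKIdx (bg9YR (Matrix (Fin N) (Fin N) ℂ) (specialUnitaryUnits (Fin N)) R₁ R₂ x) (fun U => U) U) (R := (1 : ℝ)) (H := H x) ε)
    (bHXTA : ∀ x : MemberY d ℓ hd hL b₀ b₁ Mstar, (bg9YR (Matrix (Fin N) (Fin N) ℂ) (specialUnitaryUnits (Fin N)) R₁ R₂ x).Cfg → ℝ →
      BlockNorm (toB6 (geo9Y x) 1 (H x)) (XBK (TrIdx N) x.toKIdx → ℝ))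
    (hbHXTA : ∀ (x : MemberY d ℓ hd hL b₀ b₁ Mstar) (U : (bg9YR (Matrix (Fin N) (Fin N) ℂ) (specialUnitaryUnits (Fin N)) R₁ R₂ x).Cfg), bHXTA x U = fun ε =>
      letI : Fintype (geo9K x.toKIdx).Site := (inferInstance : Fintype (geo9Y x).Site)
      bHZKPIfam (κ := TrIdx N) x.toKIdx (trBasis N) (taxiB x.toKIdx (bg9YR (Matrix (Fin N) (Fin N) ℂ) (specialUnitaryUnits (Fin N)) R₁ R₂ x) (fun U => U) U) (R := (1 : ℝ)) (H := H x) ε)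
    -- print's class (3.35) at the letters (the certificate's `hRP1 … .2.1`, `c35Y_le_ten`)
    {c c10 : ℝ} (hc10 : c10 ≤ 10)
    (hP : ∀ (x : MemberY d ℓ hd hL b₀ b₁ Mstar) (α₀ : ℝ) (U : (bg9YR (Matrix (Fin N) (Fin N) ℂ) (specialUnitaryUnits (Fin N)) R₁ R₂ x).Cfg),
      (bg9YR (Matrix (Fin N) (Fin N) ℂ) (specialUnitaryUnits (Fin N)) R₁ R₂ x).Reg335 c α₀ U → (bg9KP (Matrix (Fin N) (Fin N) ℂ) (specialUnitaryUnits (Fin N)) x.toKIdx).Reg335 c10 α₀ U)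
    -- the G₀ layer at the TRANSPORTED bond input class, in its regime
    {MT aT δ12₀ δ12₃ B0T : ℝ} {BhT BiT : ℝ → ℝ} {Bi2T : ℝ → ℝ → ℝ} (haT : 0 < aT) (hδ30 : 0 ≤ δ12₃) (hδ₃₀ : δ12₃ ≤ δ12₀)
    (hBiT : ∀ ε, 0 < ε → ε ≤ 1 → 0 ≤ BiT ε) (hBi2T : ∀ ε β', 0 < ε → ε ≤ 1 → 0 ≤ β' → β' < 1 → 0 ≤ Bi2T ε β')
    (hG0CT : ∀ x : MemberY d ℓ hd hL b₀ b₁ Mstar, MT ≤ (geo9Y x).M → ∀ α₀ : ℝ, 0 < α₀ → (geo9Y x).M * α₀ ≤ aT →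
      ∀ U : (bg9YR (Matrix (Fin N) (Fin N) ℂ) (specialUnitaryUnits (Fin N)) R₁ R₂ x).Cfg, (bg9YR (Matrix (Fin N) (Fin N) ℂ) (specialUnitaryUnits (Fin N)) R₁ R₂ x).Reg335 c α₀ U →
        (bg9YR (Matrix (Fin N) (Fin N) ℂ) (specialUnitaryUnits (Fin N)) R₁ R₂ x).Reg336 c α₀ U → Thm33G0Dir (𝔬12 x) (𝔭A x) (Dd x) (Dds x) 1 (H x) (bHXTA x U) B0T BhT BiT Bi2T δ12₀ U) :
    ∃ (MD : ℝ) (BdT : ℝ → ℝ) (Bd2T : ℝ → ℝ → ℝ), MT ≤ MD ∧ (∀ ε, 0 < ε → ε ≤ 1 → 0 ≤ BdT ε) ∧ (∀ ε β', 0 < ε → ε ≤ 1 → 0 ≤ β' → β' < 1 → 0 ≤ Bd2T ε β') ∧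
      ∀ x : MemberY d ℓ hd hL b₀ b₁ Mstar, MD ≤ (geo9Y x).M → ∀ α₀ : ℝ, 0 < α₀ → (geo9Y x).M * α₀ ≤ aT →
        ∀ U : (bg9YR (Matrix (Fin N) (Fin N) ℂ) (specialUnitaryUnits (Fin N)) R₁ R₂ x).Cfg, (bg9YR (Matrix (Fin N) (Fin N) ℂ) (specialUnitaryUnits (Fin N)) R₁ R₂ x).Reg335 c α₀ U →
          (bg9YR (Matrix (Fin N) (Fin N) ℂ) (specialUnitaryUnits (Fin N)) R₁ R₂ x).Reg336 c α₀ U →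
            (∀ (ν : Fin (d + 1)) (ε : ℝ), 0 < ε → ε ≤ 1 →
              HasMaj (bHXT x U ε) (BlockNorm.ofBlocks (toB6 (geo9Y x) 1 (H x)) (𝔬12 x).blk) (Dd x U ν ∘ₗ ((𝔬12 x).G0 U ∘ₗ (𝔬12 x).Dv U))
                (fun (a a' : (geo9Y x).Site) => BdT ε * Real.exp (-(δ12₃ * (geo9Y x).dist a a')))) ∧
            (∀ (ν : Fin (d + 1)) (ε β' : ℝ), 0 < ε → ε ≤ 1 → 0 ≤ β' → β' < 1 →
              HasMaj (bHXT x U (β' + ε)) (BlockNorm.ofBlocks (toB6 (geo9Y x) 1 (H x)) (𝔭A x).blkPX) (((𝔭A x).ΦX U β' ∘ₗ Dd x U ν) ∘ₗ ((𝔬12 x).G0 U ∘ₗ (𝔬12 x).Dv U))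
                (fun (a a' : (geo9Y x).Site) => Bd2T ε β' * (geo9Y x).len a ^ (-β') * Real.exp (-(δ12₃ * (geo9Y x).dist a a')))) := by
  haveI : Nonempty (Fin N) := ⟨⟨0, Nat.pos_of_ne_zero (NeZero.ne N)⟩⟩
  set L : ℝ := ((ℓ + 1 : ℕ) : ℝ) with hLdef
  have hL1 : (1 : ℝ) ≤ L := by rw [hLdef]; exact_mod_cast Nat.succ_le_succ (Nat.zero_le ℓ)
  -- the (2.60) transfer threshold at rate 1 and the (2.61) row sum at margin 1
  set Mtr : ℝ := Real.log (((ℓ + 1 : ℕ) : ℝ)) / (1 * (2 * ((ℓ : ℝ) + 1) ^ 2 - 1)) with hMtr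
  obtain ⟨ML, c₁, hrow⟩ := rowSum261_geo9Y (d := d) (ℓ := ℓ) (hd := hd) (hL := hL) (b₀ := b₀) (b₁ := b₁) (Mstar := Mstar) 1 one_pos
  set cR : ℝ := max c₁ 0 with hcRdef
  have hcR : 0 ≤ cR := le_max_right _ _
  -- the ladder constant on the regime `Mα₀ ≤ aT`
  set KT : ℝ := 10 * L * aT with hKT
  set Θ : ℝ := (((d + 1 : ℕ) : ℝ)) * (2 * KT * (1 + KT) * Real.exp (4 * KT)) * L ^ 6 with hΘdef
  have hΘ : 0 ≤ Θ := by positivity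
  -- the letter constant and the two profiles
  set CJ : ℝ := L * (L ^ 4 * coordBound39 (trBasis N) * basisBound39 (trBasis N) * (3 + 2 * L ^ 2 + 2 * Θ * L ^ 3)) *
    Real.exp ((δ12₃ + 1 + 1) * (2 * (rNear d ℓ + 1) + 2 * (((d : ℝ) + 1) * (((ℓ : ℝ) + 1) + 1) + 2))) with hCJ
  have hcb : 0 ≤ coordBound39 (trBasis N) := by unfold coordBound39; exact norm_nonneg _
  have hbb : 0 ≤ basisBound39 (trBasis N) := Finset.sum_nonneg fun _ _ => norm_nonneg _
  have hCJ0 : 0 ≤ CJ := by positivity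
  set BdT : ℝ → ℝ := fun ε => (((d + 1 : ℕ) : ℝ)) * ((1 + CLip d ℓ) * BiT ε * CJ * cR) with hBdT
  set Bd2T : ℝ → ℝ → ℝ := fun ε β' => (((d + 1 : ℕ) : ℝ)) * ((1 + CLip d ℓ) * Bi2T ε β' * CJ * cR) with hBd2T
  have hCL : 0 ≤ 1 + CLip d ℓ := by have := CLip_nonneg d ℓ; linarith
  refine ⟨max MT (max Mtr ML), BdT, Bd2T, le_max_left _ _, fun ε h0 h1 => by positivity [hBiT ε h0 h1],
    fun ε β' h0 h1 hb0 hb1 => by positivity [hBi2T ε β' h0 h1 hb0 hb1], fun x hM α₀ hα ha U hU hU' => ?_⟩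
  letI : Fintype (geo9K x.toKIdx).Site := (inferInstance : Fintype (geo9Y x).Site)
  have hMTx : MT ≤ (geo9Y x).M := (le_max_left _ _).trans hM
  have hMtrx : Mtr ≤ (geo9Y x).M := ((le_max_left _ _).trans (le_max_right _ _)).trans hM
  have hMLx : ML ≤ (geo9Y x).M := ((le_max_right _ _).trans (le_max_right _ _)).trans hM
  have hG : GeoOK (geo9K x.toKIdx) := ⟨geo9Y_dist_triangle x, geo9Y_dist_comm x, geo9K_dist_nonneg x.toKIdx, geo9Y_len_pos x⟩
  have hrowx : RowSum (toB6 (geo9K x.toKIdx) 1 (H x)) 1 cR := fun y => (hrow x hMLx y).trans (le_max_left _ _)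
  have htr : Real.log (geo9K x.toKIdx).L ≤ 1 * (2 * ((ℓ : ℝ) + 1) ^ 2 - 1) * (geo9K x.toKIdx).M := transfer_threshold_geo9K x.toKIdx one_pos hMtrx
  -- print's class at this member: SU(N)-valued, contracting links
  have hreg := hP x α₀ U hU
  have hG1 : ∀ u : (Matrix (Fin N) (Fin N) ℂ)ˣ, u ∈ specialUnitaryUnits (Fin N) → ‖(u : Matrix (Fin N) (Fin N) ℂ)‖ ≤ 1 := fun u hu => (specialUnitaryUnits_le_U1 hu).1
  have hUL : ∀ (μ' : Fin (d + 1)) (t : Site (B6GlobalChartV1.PV d ℓ x.toKIdx.m x.toKIdx.K hd hL) 0), UnitaryLike (U μ' t) :=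
    fun μ' t => norm_le_one_and_inv_of_mem (specialUnitaryUnits (Fin N)) hG1 (mem_of_reg335P x.toKIdx hreg μ' t)
  have h01 : (0 : ℝ) ≤ 1 := zero_le_one
  have h01' : (0 : ℝ) < 1 := one_pos
  have hcf : |x.toKIdx.cf| = (B6Prop22KLevelTorusCensusEta.nKT (toKT x.toKIdx) : ℝ) := abs_cf_eq_nKT x.toKIdx x.hcfk
  have hMα : 0 ≤ (kGeo x.toKIdx).M * α₀ := by
    have e : (kGeo x.toKIdx).M = (geo9Y x).M := rfl
    rw [e, B9PinMembersKLevelV1.geo9Y_M]; positivity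
  -- the ladder on admissible pairs, with Θ(α₀) ≤ Θ(aT)
  have hK : 10 * (kGeo x.toKIdx).L * ((kGeo x.toKIdx).M * α₀) ≤ KT := by
    rw [hKT, hLdef]; exact mul_le_mul_of_nonneg_left ha (by positivity)
  have hK0 : 0 ≤ 10 * (kGeo x.toKIdx).L * ((kGeo x.toKIdx).M * α₀) := by positivity
  have hlad : ∀ (μ : Fin (d + 1)) (y y' : Site (B6GlobalChartV1.PV d ℓ x.toKIdx.m x.toKIdx.K hd hL) 0), Adm x.toKIdx ⟨y, μ⟩ ⟨y', μ⟩ →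
      ‖((parTaxiV U y y' * U μ y' * (parTaxiV U (y.shift μ) (y'.shift μ))⁻¹ * (U μ y)⁻¹ : (Matrix (Fin N) (Fin N) ℂ)ˣ) : Matrix (Fin N) (Fin N) ℂ) - 1‖ ≤
        Θ * ((LatticeFieldCalculus.supDist y y' : ℝ) / (((ℓ + 1 : ℕ) : ℝ)) ^ levY x.toKIdx (chartY x.toKIdx y')) := by
    intro μ y y' hadm
    refine (jLadder_hyp_of_reg335P x.toKIdx U hc10 hMα hreg hG1 μ y y' hadm).trans (mul_le_mul_of_nonneg_right ?_ (by positivity))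
    rw [hΘdef, hLdef]
    have hexp : Real.exp (4 * (10 * (kGeo x.toKIdx).L * ((kGeo x.toKIdx).M * α₀))) ≤ Real.exp (4 * KT) := Real.exp_le_exp.2 (by linarith)
    have h1 : 2 * (10 * (kGeo x.toKIdx).L * ((kGeo x.toKIdx).M * α₀)) * (1 + 10 * (kGeo x.toKIdx).L * ((kGeo x.toKIdx).M * α₀)) *
        Real.exp (4 * (10 * (kGeo x.toKIdx).L * ((kGeo x.toKIdx).M * α₀))) ≤ 2 * KT * (1 + KT) * Real.exp (4 * KT) :=
      mul_le_mul (mul_le_mul (by linarith) (by linarith) (by positivity) (by positivity)) hexp (by positivity) (by positivity)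
    exact mul_le_mul_of_nonneg_right (mul_le_mul_of_nonneg_left h1 (by positivity)) (by positivity)
  have hLay := hG0CT x hMTx α₀ hα ha U hU hU'
  refine ⟨fun ν ε h0 h1 => ?_, fun ν ε β' h0 h1 hb0 hb1 => ?_⟩
  · -- `hdgDvd13` at the transported class
    have h44 : ∀ μ : Fin (d + 1), HasMaj (bHZKPIfam (κ := TrIdx N) x.toKIdx (trBasis N) (taxiB x.toKIdx (bg9YR (Matrix (Fin N) (Fin N) ℂ) (specialUnitaryUnits (Fin N)) R₁ R₂ x)
        (fun U => U) U) (R := (1 : ℝ)) (H := H x) ε) (BlockNorm.ofBlocks (toB6 (geo9K x.toKIdx) 1 (H x)) (𝔬12 x).blk)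
        (Dd x U ν ∘ₗ ((𝔬12 x).G0 U ∘ₗ Dds x U μ)) (fun (a a' : IBondY x.toKIdx) => BiT ε * Real.exp (-(δ12₀ * (geo9K x.toKIdx).dist a a'))) := by
      intro μ
      have h := hLay.h44m (ν, μ) ε h0 h1
      rw [hbHXTA x U] at h
      exact h
    have key := hasMaj_dgDv_of_h44m (κ := TrIdx N) x.toKIdx (trBasis N) (B := bg9YR (Matrix (Fin N) (Fin N) ℂ) (specialUnitaryUnits (Fin N)) R₁ R₂ x) (fun U => U) U (R₀ := (1 : ℝ)) (H₀ := H x) (bI := bI x) hG (σ := 1) (c := cR) hrowx h01 hUL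
      (hβ1 x) hcf (εt := 1) h01' htr (Θ := Θ) hΘ hlad (blk := (𝔬12 x).blk) (A := Dd x U ν) (G0 := (𝔬12 x).G0 U) (Dds := Dds x U) (hDds x U)
      (ε := ε) (Bi := BiT ε) (δ₀ := δ12₀) (ρ := δ12₃) (Bo := BdT ε) h0 (hBiT ε h0 h1) hδ30 hδ₃₀ h44 (le_of_eq (by rw [hBdT, hCJ, hLdef]))
    rw [hbHXT x U, hDvco12 x U]
    exact key
  · -- `hpdgDvd13` at the transported class
    have hε' : 0 < β' + ε := by linarith
    have h45 : ∀ μ : Fin (d + 1), HasMaj (bHZKPIfam (κ := TrIdx N) x.toKIdx (trBasis N) (taxiB x.toKIdx (bg9YR (Matrix (Fin N) (Fin N) ℂ) (specialUnitaryUnits (Fin N)) R₁ R₂ x)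
        (fun U => U) U) (R := (1 : ℝ)) (H := H x) (β' + ε)) (BlockNorm.ofBlocks (toB6 (geo9K x.toKIdx) 1 (H x)) (𝔭A x).blkPX)
        (((𝔭A x).ΦX U β' ∘ₗ Dd x U ν) ∘ₗ ((𝔬12 x).G0 U ∘ₗ Dds x U μ))
        (fun (a a' : IBondY x.toKIdx) => Bi2T ε β' * (geo9K x.toKIdx).len a ^ (-β') * Real.exp (-(δ12₀ * (geo9K x.toKIdx).dist a a'))) := by
      intro μ
      have h := hLay.h45m (ν, μ) ε β' h0 h1 hb0 hb1
      rw [hbHXTA x U] at h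
      exact h
    have key := hasMaj_pdgDv_of_h45m (κ := TrIdx N) x.toKIdx (trBasis N) (B := bg9YR (Matrix (Fin N) (Fin N) ℂ) (specialUnitaryUnits (Fin N)) R₁ R₂ x) (fun U => U) U (R₀ := (1 : ℝ)) (H₀ := H x) (bI := bI x) hG (σ := 1) (c := cR) hrowx h01 hUL
      (hβ1 x) hcf (εt := 1) h01' htr (Θ := Θ) hΘ hlad (blkP := (𝔭A x).blkPX) (A := (𝔭A x).ΦX U β' ∘ₗ Dd x U ν) (G0 := (𝔬12 x).G0 U) (Dds := Dds x U) (hDds x U)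
      (ε := β' + ε) (βp := β') (Bi := Bi2T ε β') (δ₀ := δ12₀) (ρ := δ12₃) (Bo := Bd2T ε β') hε' (hBi2T ε β' h0 h1 hb0 hb1) hδ30 hδ₃₀ h45
      (le_of_eq (by rw [hBd2T, hCJ, hLdef]))
    rw [hbHXT x U, hDvco12 x U]
    exact key


/-- ★★★ **v1.1 — THE SAME TWO LETTERS FOR EVERY `ε > 0`** (dag-n06-d's ask I.≈31770: the U8 producer consumes them at the W member's own exponent): beyond `ε ≤ 1` the print-exact
families ARE the `s = ½` classes (`bHZPIfam_of_not_mem`), so the `ε ≤ 1` letters at `ε₀ = ½` (resp. `(1, β′)` for `β′ > 0`, `(½, 0)` for `β′ = 0`) serve, with the profiles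
re-indexed accordingly. [cite: Balaban1985BackgroundPropagators, Thm 3.3 (3.45) p.398 + (3.44) p.398 + (3.3) p.391; Balaban1984PropagatorsII, (2.51)–(2.56) pp.232–233] -/
theorem dgDvd_pdgDvd_of_pinsT_all {R₁ R₂ : RegFamY d ℓ hd hL b₀ b₁ Mstar (Matrix (Fin N) (Fin N) ℂ)} (H : MemberY d ℓ hd hL b₀ b₁ Mstar → Prop)
    (bI : ∀ x : MemberY d ℓ hd hL b₀ b₁ Mstar, FBondY x.toKIdx → IBondY x.toKIdx)
    (hβ1 : ∀ (x : MemberY d ℓ hd hL b₀ b₁ Mstar) (f : FBondY x.toKIdx),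
      (geomT x.toKIdx.D).dist (β x.toKIdx.hN x.toKIdx.D x.toKIdx.hk (bI x f)) (blkV1 x.toKIdx.hN x.toKIdx.D f) ≤ 1)
    {Z12 : MemberY d ℓ hd hL b₀ b₁ Mstar → Type} [∀ x, Fintype (Z12 x)] {PXA PYA : MemberY d ℓ hd hL b₀ b₁ Mstar → Type} [∀ x, Fintype (PXA x)] [∀ x, Fintype (PYA x)]
    (𝔬12 : ∀ x : MemberY d ℓ hd hL b₀ b₁ Mstar, B9Thm312Whole.Ops (geo9Y x) (bg9YR (Matrix (Fin N) (Fin N) ℂ) (specialUnitaryUnits (Fin N)) R₁ R₂ x)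
      (XBK (TrIdx N) x.toKIdx) (XBK (TrIdx N) x.toKIdx) (Z12 x) (XSK (TrIdx N) x.toKIdx))
    (𝔭A : ∀ x : MemberY d ℓ hd hL b₀ b₁ Mstar, HolderProbes (geo9Y x) (bg9YR (Matrix (Fin N) (Fin N) ℂ) (specialUnitaryUnits (Fin N)) R₁ R₂ x)
      (XBK (TrIdx N) x.toKIdx) (XBK (TrIdx N) x.toKIdx) (PXA x) (PYA x))
    (Dd Dds : ∀ x : MemberY d ℓ hd hL b₀ b₁ Mstar, (bg9YR (Matrix (Fin N) (Fin N) ℂ) (specialUnitaryUnits (Fin N)) R₁ R₂ x).Cfg → Fin (d + 1) →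
      Module.End ℝ (XBK (TrIdx N) x.toKIdx → ℝ))
    (hDds : ∀ (x : MemberY d ℓ hd hL b₀ b₁ Mstar) (U : (bg9YR (Matrix (Fin N) (Fin N) ℂ) (specialUnitaryUnits (Fin N)) R₁ R₂ x).Cfg),
      Dds x U = fun μ => coordOpK (trBasis N) (fun _ : Fin (d + 1) => cdsBₗ x.toKIdx U μ))
    (hDvco12 : ∀ (x : MemberY d ℓ hd hL b₀ b₁ Mstar) (U : (bg9YR (Matrix (Fin N) (Fin N) ℂ) (specialUnitaryUnits (Fin N)) R₁ R₂ x).Cfg),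
      (𝔬12 x).Dv U = DvcoKH x.toKIdx (trBasis N) (bg9YR (Matrix (Fin N) (Fin N) ℂ) (specialUnitaryUnits (Fin N)) R₁ R₂ x) (fun U => U) U)
    -- the transported input classes of record (ED.95's `hbHXT ∕ hbHXTA`)
    (bHXT : ∀ x : MemberY d ℓ hd hL b₀ b₁ Mstar, (bg9YR (Matrix (Fin N) (Fin N) ℂ) (specialUnitaryUnits (Fin N)) R₁ R₂ x).Cfg → ℝ →
      BlockNorm (toB6 (geo9Y x) 1 (H x)) (XSK (TrIdx N) x.toKIdx → ℝ))
    (hbHXT : ∀ (x : MemberY d ℓ hd hL b₀ b₁ Mstar) (U : (bg9YR (Matrix (Fin N) (Fin N) ℂ) (specialUnitaryUnits (Fin N)) R₁ R₂ x).Cfg), bHXT x U = fun ε =>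
      letI : Fintype (geo9K x.toKIdx).Site := (inferInstance : Fintype (geo9Y x).Site)
      bHZPIfam (κ := TrIdx N) x.toKIdx (trBasis N) (taxiS x.toKIdx (bg9YR (Matrix (Fin N) (Fin N) ℂ) (specialUnitaryUnits (Fin N)) R₁ R₂ x) (fun U => U) U) (R := (1 : ℝ)) (H := H x) ε)
    (bHXTA : ∀ x : MemberY d ℓ hd hL b₀ b₁ Mstar, (bg9YR (Matrix (Fin N) (Fin N) ℂ) (specialUnitaryUnits (Fin N)) R₁ R₂ x).Cfg → ℝ →
      BlockNorm (toB6 (geo9Y x) 1 (H x)) (XBK (TrIdx N) x.toKIdx → ℝ))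
    (hbHXTA : ∀ (x : MemberY d ℓ hd hL b₀ b₁ Mstar) (U : (bg9YR (Matrix (Fin N) (Fin N) ℂ) (specialUnitaryUnits (Fin N)) R₁ R₂ x).Cfg), bHXTA x U = fun ε =>
      letI : Fintype (geo9K x.toKIdx).Site := (inferInstance : Fintype (geo9Y x).Site)
      bHZKPIfam (κ := TrIdx N) x.toKIdx (trBasis N) (taxiB x.toKIdx (bg9YR (Matrix (Fin N) (Fin N) ℂ) (specialUnitaryUnits (Fin N)) R₁ R₂ x) (fun U => U) U) (R := (1 : ℝ)) (H := H x) ε)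
    -- print's class (3.35) at the letters (the certificate's `hRP1 … .2.1`, `c35Y_le_ten`)
    {c c10 : ℝ} (hc10 : c10 ≤ 10)
    (hP : ∀ (x : MemberY d ℓ hd hL b₀ b₁ Mstar) (α₀ : ℝ) (U : (bg9YR (Matrix (Fin N) (Fin N) ℂ) (specialUnitaryUnits (Fin N)) R₁ R₂ x).Cfg),
      (bg9YR (Matrix (Fin N) (Fin N) ℂ) (specialUnitaryUnits (Fin N)) R₁ R₂ x).Reg335 c α₀ U → (bg9KP (Matrix (Fin N) (Fin N) ℂ) (specialUnitaryUnits (Fin N)) x.toKIdx).Reg335 c10 α₀ U)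
    -- the G₀ layer at the TRANSPORTED bond input class, in its regime
    {MT aT δ12₀ δ12₃ B0T : ℝ} {BhT BiT : ℝ → ℝ} {Bi2T : ℝ → ℝ → ℝ} (haT : 0 < aT) (hδ30 : 0 ≤ δ12₃) (hδ₃₀ : δ12₃ ≤ δ12₀)
    (hBiT : ∀ ε, 0 < ε → ε ≤ 1 → 0 ≤ BiT ε) (hBi2T : ∀ ε β', 0 < ε → ε ≤ 1 → 0 ≤ β' → β' < 1 → 0 ≤ Bi2T ε β')
    (hG0CT : ∀ x : MemberY d ℓ hd hL b₀ b₁ Mstar, MT ≤ (geo9Y x).M → ∀ α₀ : ℝ, 0 < α₀ → (geo9Y x).M * α₀ ≤ aT →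
      ∀ U : (bg9YR (Matrix (Fin N) (Fin N) ℂ) (specialUnitaryUnits (Fin N)) R₁ R₂ x).Cfg, (bg9YR (Matrix (Fin N) (Fin N) ℂ) (specialUnitaryUnits (Fin N)) R₁ R₂ x).Reg335 c α₀ U →
        (bg9YR (Matrix (Fin N) (Fin N) ℂ) (specialUnitaryUnits (Fin N)) R₁ R₂ x).Reg336 c α₀ U → Thm33G0Dir (𝔬12 x) (𝔭A x) (Dd x) (Dds x) 1 (H x) (bHXTA x U) B0T BhT BiT Bi2T δ12₀ U) :
    ∃ (MD : ℝ) (BdT : ℝ → ℝ) (Bd2T : ℝ → ℝ → ℝ), MT ≤ MD ∧ (∀ ε, 0 < ε → 0 ≤ BdT ε) ∧ (∀ ε β', 0 < ε → 0 ≤ β' → β' < 1 → 0 ≤ Bd2T ε β') ∧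
      ∀ x : MemberY d ℓ hd hL b₀ b₁ Mstar, MD ≤ (geo9Y x).M → ∀ α₀ : ℝ, 0 < α₀ → (geo9Y x).M * α₀ ≤ aT →
        ∀ U : (bg9YR (Matrix (Fin N) (Fin N) ℂ) (specialUnitaryUnits (Fin N)) R₁ R₂ x).Cfg, (bg9YR (Matrix (Fin N) (Fin N) ℂ) (specialUnitaryUnits (Fin N)) R₁ R₂ x).Reg335 c α₀ U →
          (bg9YR (Matrix (Fin N) (Fin N) ℂ) (specialUnitaryUnits (Fin N)) R₁ R₂ x).Reg336 c α₀ U →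
            (∀ (ν : Fin (d + 1)) (ε : ℝ), 0 < ε →
              HasMaj (bHXT x U ε) (BlockNorm.ofBlocks (toB6 (geo9Y x) 1 (H x)) (𝔬12 x).blk) (Dd x U ν ∘ₗ ((𝔬12 x).G0 U ∘ₗ (𝔬12 x).Dv U))
                (fun (a a' : (geo9Y x).Site) => BdT ε * Real.exp (-(δ12₃ * (geo9Y x).dist a a')))) ∧
            (∀ (ν : Fin (d + 1)) (ε β' : ℝ), 0 < ε → 0 ≤ β' → β' < 1 →
              HasMaj (bHXT x U (β' + ε)) (BlockNorm.ofBlocks (toB6 (geo9Y x) 1 (H x)) (𝔭A x).blkPX) (((𝔭A x).ΦX U β' ∘ₗ Dd x U ν) ∘ₗ ((𝔬12 x).G0 U ∘ₗ (𝔬12 x).Dv U))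
                (fun (a a' : (geo9Y x).Site) => Bd2T ε β' * (geo9Y x).len a ^ (-β') * Real.exp (-(δ12₃ * (geo9Y x).dist a a')))) := by
  classical
  obtain ⟨MD, BdT, Bd2T, hMD, hBdT, hBd2T, hall⟩ := dgDvd_pdgDvd_of_pinsT H bI hβ1 𝔬12 𝔭A Dd Dds hDds hDvco12 bHXT hbHXT bHXTA hbHXTA hc10 hP haT hδ30 hδ₃₀
    hBiT hBi2T hG0CT
  have h12 : (0 : ℝ) < 1 / 2 := by norm_num
  have h12' : (1 : ℝ) / 2 ≤ 1 := by norm_num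
  refine ⟨MD, fun ε => if ε ≤ 1 then BdT ε else BdT (1 / 2), fun ε β' => if ε ≤ 1 then Bd2T ε β' else if 0 < β' then Bd2T 1 β' else Bd2T (1 / 2) β', hMD,
    fun ε hε => ?_, fun ε β' hε h0 h1 => ?_, fun x hM α₀ hα ha U hU hU' => ?_⟩
  · beta_reduce
    by_cases h : ε ≤ 1
    · rw [if_pos h]; exact hBdT ε hε h
    · rw [if_neg h]; exact hBdT (1 / 2) h12 h12'
  · beta_reduce
    by_cases h : ε ≤ 1
    · rw [if_pos h]; exact hBd2T ε β' hε h h0 h1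
    · rw [if_neg h]
      by_cases hb : 0 < β'
      · rw [if_pos hb]; exact hBd2T 1 β' one_pos le_rfl h0 h1
      · rw [if_neg hb]; exact hBd2T (1 / 2) β' h12 h12' h0 h1
  letI : Fintype (geo9K x.toKIdx).Site := (inferInstance : Fintype (geo9Y x).Site)
  obtain ⟨hA, hB⟩ := hall x hM α₀ hα ha U hU hU'
  -- the class beyond `1` is the `½` class
  have hcl : ∀ {e e' : ℝ}, ¬ (0 ≤ e ∧ e ≤ 1) → ¬ (0 ≤ e' ∧ e' ≤ 1) → bHXT x U e = bHXT x U e' := by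
    intro e e' he he'
    rw [hbHXT x U]
    simp only
    rw [B9GradLetterTransportedInputClassesPI.bHZPIfam_of_not_mem x.toKIdx (trBasis N) _ he,
      B9GradLetterTransportedInputClassesPI.bHZPIfam_of_not_mem x.toKIdx (trBasis N) _ he']
  have hcl' : ∀ {e : ℝ}, ¬ (0 ≤ e ∧ e ≤ 1) → bHXT x U e = bHXT x U (1 / 2) := by
    intro e he
    rw [hbHXT x U]
    simp only
    rw [B9GradLetterTransportedInputClassesPI.bHZPIfam_of_not_mem x.toKIdx (trBasis N) _ he,
      B9SmoothHolderClassPI.bHZPIfam_of_mem x.toKIdx (trBasis N) _ h12.le h12']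
  refine ⟨fun ν ε hε => ?_, fun ν ε β' hε h0 h1 => ?_⟩
  · by_cases h : ε ≤ 1
    · simp only [if_pos h]; exact hA ν ε hε h
    · simp only [if_neg h]
      rw [hcl' (fun hh => h hh.2)]
      exact hA ν (1 / 2) h12 h12'
  · by_cases h : ε ≤ 1
    · simp only [if_pos h]; exact hB ν ε β' hε h h0 h1
    · simp only [if_neg h]
      by_cases hb : 0 < β'
      · simp only [if_pos hb]
        have hn1 : ¬ (0 ≤ β' + ε ∧ β' + ε ≤ 1) := fun hh => h (by linarith [hh.2])
        have hn2 : ¬ (0 ≤ β' + 1 ∧ β' + 1 ≤ 1) := fun hh => by linarith [hh.2]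
        rw [hcl hn1 hn2]
        exact hB ν 1 β' one_pos le_rfl h0 h1
      · simp only [if_neg hb]
        have hb0 : β' = 0 := le_antisymm (not_lt.1 hb) h0
        have hn1 : ¬ (0 ≤ β' + ε ∧ β' + ε ≤ 1) := fun hh => h (by linarith [hh.2])
        rw [hcl' hn1]
        have h' := hB ν (1 / 2) β' h12 h12' h0 h1
        subst hb0
        rw [zero_add] at h'
        exact h'

end Summit.QuantumFields.YangMills.BalabanUVNodes.N06DgDvdLegAtPinsT

end
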